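import Mathlib
import HarnessLib
import Summits.HodgeConjecture.HodgeConjecture.Theses.HeckePrymWeil
import Literature.AlgebraicGeometry.Motives.Sweep1
import Literature.AlgebraicGeometry.Motives.AbelianVarietyProjectiveChart
import Literature.AlgebraicGeometry.HodgeTheory.GysinFormalismCorrespondences
import Literature.AlgebraicGeometry.HodgeTheory.FermatHodgeConjecture

/-!
# Crux HodgeWeilLadder (stmt-HodgeConjecture-1259) — ideator 3, round 1: first lemmas

Sketch file of planner-cruxidea-stmt-HodgeConjecture-1259-3-0. Two crux idea cards:

* `aoki-fermat-anchors` — Fermat points of the ladder (Aoki 2000: the Hodge conjecture for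
  abelian varieties of Fermat type of degree `m ∈ {pᵉ, 2pᵉ, 2ᵃ3ᵇ5ᶜ7ᵈ (c = 0 ∨ d = 0)}`), incl. the
  `p = 7` strand: the Frobenius group `F₂₁` acts freely on the Fermat curve `F₂₁` and on `F₂₁/M`.
* `lefschetz-pencil-transport` — `Λ_Ȳ ∘ ι_{s*}` is parallel transport: the rung on a compact Weil
  pencil is equivalent to the standard conjecture `B` for the pencil; transfer statement.

Everything here elaborates against the live route module; `sorry` only in posited facts' USERS, never
in definitions. Nothing in this file is a route item.
-/

noncomputable section

open CategoryTheory AlgebraicGeometry MonoidalCategory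
open Literature.AlgebraicGeometry Literature.AlgebraicGeometry.Motives
open Literature.AlgebraicGeometry.HodgeTheory
open Literature.AlgebraicTopology.SingularHomology

namespace Summit.HodgeConjecture.HodgeConjecture.Cruxes.HodgeWeilLadder.IdeatorThree

open Summit.HodgeConjecture.HodgeConjecture.Theses.HeckePrymWeil

/-! ## 0. The rung predicate, unfolded (shared by both cards) -/

/-- `WeilAlg p n A φ`: the body of the crux at one `(A, φ)` — every rational `(n,n)`-class in the
Weil span (the two `(1 ± i√p)^{2n}`-eigenspaces of `(𝟙 + φ)^*` on `H^{2n}`) is algebraic. -/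
def WeilAlg (p n : ℕ) (A : AbelianVariety ℂ) (φ : A ⟶ A) : Prop :=
  A.dim = (2 * n) → CategoryStruct.comp φ φ = -((p : ℤ) • CategoryStruct.id A) →
    ∀ c : complexBetti A.X (2 * n), IsRationalClass c →
      IsOfHodgeType (2 * n) A.X (2 * n) n n c →
        c ∈ Module.End.eigenspace (complexBetti.map (CategoryStruct.id A + φ).hom.hom.hom (2 * n)).hom
              ((1 + Complex.I * (Real.sqrt (p : ℝ) : ℂ)) ^ (2 * n)) ⊔
            Module.End.eigenspace (complexBetti.map (CategoryStruct.id A + φ).hom.hom.hom (2 * n)).hom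
              ((1 - Complex.I * (Real.sqrt (p : ℝ) : ℂ)) ^ (2 * n)) →
          c ∈ algebraicClasses A.X n

/-- The crux is literally `∀ p g n A φ, WeilAlg p n A φ` over the ladder's index set. -/
theorem crux_unfold :
    HodgeWeilLadder ↔
      ∀ p : ℕ, p.Prime → p % 4 = 3 → 7 ≤ p → ∀ g : ℕ, 2 ≤ g → ∀ n : ℕ, n = (p - 1) / 2 * (g - 1) →
        ∀ (A : AbelianVariety ℂ) (φ : A ⟶ A), WeilAlg p n A φ :=
  Iff.rfl

/-! ## 1. Card `aoki-fermat-anchors` -/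

/-- Aoki's degrees (Aoki 2000, Comment. Math. Univ. St. Pauli 49, as quoted in the tree file
`HodgeTheory/FermatHodgeConjectureAoki`): `m = 2ᵃ3ᵇ5ᶜ7ᵈ > 1` with `c = 0 ∨ d = 0`, or `m = qᵉ`,
`m = 2qᵉ` for an odd prime `q`. Contains every prime `p ≥ 3` and `21 = 3·7`, `63`, `42`. -/
def IsAokiDegree (m : ℕ) : Prop :=
  (∃ a b c d : ℕ, m = 2 ^ a * 3 ^ b * 5 ^ c * 7 ^ d ∧ (c = 0 ∨ d = 0) ∧ 1 < m) ∨
    (∃ q e : ℕ, q.Prime ∧ q ≠ 2 ∧ 0 < e ∧ (m = q ^ e ∨ m = 2 * q ^ e))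

theorem isAokiDegree_twentyOne : IsAokiDegree 21 :=
  Or.inl ⟨0, 1, 0, 1, by norm_num, Or.inl rfl, by norm_num⟩

theorem isAokiDegree_prime {p : ℕ} (hp : p.Prime) (hp2 : p ≠ 2) : IsAokiDegree p :=
  Or.inr ⟨p, 1, hp, hp2, Nat.one_pos, Or.inl (pow_one p).symm⟩

/-- Iterated self-product `F^{⊗(N+1)}` of a `ℂ`-scheme (the tree's monoidal product of
`SchemeOver ℂ` = fibre product over `ℂ`). -/
def selfPower (F : SchemeOver ℂ) : ℕ → SchemeOver ℂ
  | 0 => F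
  | N + 1 => selfPower F N ⊗ F

/-- `X` is DOMINATED BY A POWER OF THE FERMAT CURVE OF DEGREE `m`: there are a smooth plane Fermat
curve `F : x₀ᵐ + x₁ᵐ + x₂ᵐ = 0` and a surjective `ℂ`-morphism `F^{N+1} → X`. Every abelian variety of
Fermat type of degree `m` in Aoki's sense (isogenous to an abelian subvariety of a power of `J(Fₘ)`)
is so dominated (addition `Fₘ^{g k} → J(Fₘ)^k`, then an isogeny/projection). -/
def IsDominatedByFermatCurvePower (m : ℕ) (X : SchemeOver ℂ) : Prop :=
  ∃ (F : SchemeOver ℂ) (N : ℕ) (π : selfPower F N ⟶ X),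
    IsFermatVariety 1 m F ∧ IsSmoothProjective 1 F ∧ Surjective π.left

/-- POSITED NAMED FACT (to be vendored in `Literature/AlgebraicGeometry/HodgeTheory`, next to
`hodgeClasses_algebraic_fermat`): **Aoki 2000 + projection formula.** For `m` an Aoki degree, the
Hodge conjecture (cycle part, real carriers) holds for every smooth projective `X` dominated by a
power of the Fermat curve of degree `m`. Printed source: Aoki, Comment. Math. Univ. St. Pauli 49
(2000) 177–194 ("the Hodge conjecture holds for abelian varieties of Fermat type of degree `m`
whenever `m = 2ᵃ3ᵇ5ᶜ7ᵈ` with `c = 0` or `d = 0`, or `m = pᵉ`, `2pᵉ`"); `HC(J(Fₘ)^k ∀ k) ⇒ HC(Fₘ^N ∀ N)`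
(restriction of Hodge classes along `Fₘ^N ↪ J^N`, semisimplicity) `⇒ HC(X)` for `X` dominated by
`Fₘ^N` (`π_*(π^* c ∪ h^r) = deg · c`). -/
def Aoki2000FermatTypeHC : Prop :=
  ∀ ⦃m n : ℕ⦄ ⦃X : SchemeOver ℂ⦄, IsAokiDegree m → IsDominatedByFermatCurvePower m X →
    IsSmoothProjective n X →
      ∀ (q : ℕ) (c : complexBetti X (2 * q)), IsRationalClass c → IsOfHodgeType n X (2 * q) q q c →
        c ∈ algebraicClasses X q

/-- FIRST LEMMA of `aoki-fermat-anchors` (provable now from the posited fact): **Fermat-type members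
of every rung satisfy the rung predicate** — at an abelian variety dominated by a power of a Fermat
curve of Aoki degree (e.g. degree `p` itself, or `21` for the `F₂₁`-strand), the Weil classes are
algebraic, whatever the discriminant. The Weil-span hypothesis is not even used: ALL Hodge classes
are algebraic there (Aoki). -/
theorem weilAlg_of_fermatType (hA : Aoki2000FermatTypeHC) {p n m : ℕ} (hm : IsAokiDegree m)
    (A : AbelianVariety ℂ) (φ : A ⟶ A) (hdom : IsDominatedByFermatCurvePower m A.X) :
    WeilAlg p n A φ := by
  intro hdim _ c hc hH _
  have hsp : IsSmoothProjective (2 * n) A.X := by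
    have h := (AbelianVariety.isSmoothProjective_holds (A := A))
    rw [AbelianVariety.isSmoothProjective, hdim] at h
    exact h
  exact hA hm hdom hsp n c hc hH

/-- Bookkeeping of the `p = 7` strand (genus arithmetic only): the Fermat curve `F₂₁` has genus
`190`; a free action of a group of order `3` (the subgroup `M`) gives genus `64`; free `F₂₁`-quotients
of `F₂₁/M` and of `F₂₁` have genera `4` and `10`, i.e. Hecke–Prym covers of type `(7,4)` and
`(7,10)`, rungs of dimension `18` and `54`. -/
theorem fermat21_genera :
    (21 - 1) * (21 - 2) / 2 = 190 ∧ (190 - 1) / 3 + 1 = 64 ∧ 2 * 64 - 2 = 42 * (4 - 1) ∧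
      2 * 190 - 2 = 42 * (10 - 1) ∧ (7 - 1) * (4 - 1) = 18 ∧ (7 - 1) * (10 - 1) = 54 := by
  norm_num

/-- The element `u = (ζ, ζ⁴, ζ²)` of `μ₇³/Δ` is normalised by the cyclic coordinate shift `τ`, which
acts on it by squaring (`2` has order `3` mod `7`): the exponent identities behind `F₂₁ ⊂ Aut(F_N)`,
`7 ∣ N`. -/
theorem frobenius21_exponents :
    (2 : ZMod 7) ^ 3 = 1 ∧ (2 : ZMod 7) ≠ 1 ∧
      ((2 : ZMod 7) * 1 = 2 ∧ (2 : ZMod 7) * 4 = 1 ∧ (2 : ZMod 7) * 2 = 4) := by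
  decide

/-! ## 2. Card `lefschetz-pencil-transport` -/

section Pencil

variable (G : GysinFormalism)

/-- ALGEBRAIC PARALLEL TRANSPORT between two fibres of a smooth projective family of relative
dimension `2N`: a `2N`-cycle `Z` on `𝒳_t ⊗ 𝒳_s` (a degree-`0` correspondence from `𝒳_s` to `𝒳_t`)
whose action carries the restriction `W|ₛ` of a global class to `W|ₜ`. For a COMPACT pencil
`𝒳 → C` this is exactly what `B(𝒳)` supplies: `Z = ι_t^* ∘ Λ_𝒳 ∘ ι_{s*}` (the card's lever). -/
def HasAlgebraicTransport {N : ℕ} {𝒳 S : SchemeOver ℂ} (f : 𝒳 ⟶ S) (W : complexBetti 𝒳 (2 * N))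
    (s t : ComplexPoints S) (hs : IsSmoothProjective (2 * N) (fiberOver f s))
    (ht : IsSmoothProjective (2 * N) (fiberOver f t)) : Prop :=
  ∃ Z : ↥(cyclesOfDim ((fiberOver f t) ⊗ (fiberOver f s)).left (2 * N)),
    G.corrActGen ht hs (d := 2 * N) (e := 2 * N) (by omega) (a := 2 * N) (b := 2 * N) rfl Z
        (complexBetti.map (fiberι f s) (2 * N) W) =
      complexBetti.map (fiberι f t) (2 * N) W

/-- FIRST LEMMA of `lefschetz-pencil-transport` (provable now, modulo the tree's standing
cup-compatibility hypothesis `hcup` of `corrActGen_mem_algebraicClasses`): algebraic transport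
moves algebraicity from the anchor fibre `s` to the fibre `t`. With `B(Ȳ)` for one compact Weil
pencil through `(A, φ)` and a split point `E^{2N}_δ`, this is the rung at `(A, φ)`. -/
theorem algebraic_of_transport {N : ℕ} {𝒳 S : SchemeOver ℂ} (f : 𝒳 ⟶ S)
    (W : complexBetti 𝒳 (2 * N)) (s t : ComplexPoints S)
    (hs : IsSmoothProjective (2 * N) (fiberOver f s)) (ht : IsSmoothProjective (2 * N) (fiberOver f t))
    (hcup : ∀ ⦃x : complexBetti ((fiberOver f t) ⊗ (fiberOver f s)) (2 * N)⦄
      ⦃y : complexBetti ((fiberOver f t) ⊗ (fiberOver f s)) (2 * (2 * N))⦄,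
      x ∈ algebraicClasses ((fiberOver f t) ⊗ (fiberOver f s)) N →
        y ∈ algebraicClasses ((fiberOver f t) ⊗ (fiberOver f s)) (2 * N) →
          cupProduct (two_mul_add_two_mul N (2 * N)) x y ∈
            algebraicClasses ((fiberOver f t) ⊗ (fiberOver f s)) (N + 2 * N))
    (hT : HasAlgebraicTransport G f W s t hs ht)
    (halg : complexBetti.map (fiberι f s) (2 * N) W ∈ algebraicClasses (fiberOver f s) N) :
    complexBetti.map (fiberι f t) (2 * N) W ∈ algebraicClasses (fiberOver f t) N := by
  obtain ⟨Z, hZ⟩ := hT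
  rw [← hZ]
  exact G.corrActGen_mem_algebraicClasses ht hs (d := 2 * N) (e := 2 * N) (by omega)
    (p := N) (q := N) (by omega) hcup Z halg

/-- TRANSFER STATEMENT of the card, pencil form: along every smooth projective family of abelian
`2M`-folds with `√-p`-multiplication over a smooth irreducible base, flat rational `(M,M)`-classes
admit algebraic transport between any two fibres. By the card this is EQUIVALENT, pencil by pencil,
to the standard conjecture `B` of the (compact) pencil, and it implies the route's transport crux
`WeilVariationalHodge` (hence, with `HeckePrymAnchors` or split anchors, the ladder via `LadderGlue`). -/
def WeilPencilTransport : Prop :=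
  ∀ p : ℕ, p.Prime → p % 4 = 3 → 7 ≤ p → ∀ M : ℕ, 1 ≤ M →
    ∀ ⦃𝒳 S : SchemeOver ℂ⦄ (f : 𝒳 ⟶ S), IsSmoothProjectiveFamily f (2 * M) → IrreducibleSpace S.left →
      AlgebraicGeometry.Smooth S.hom →
      ∀ (W : complexBetti 𝒳 (2 * M)),
        (∀ s : ComplexPoints S, IsRationalClass (complexBetti.map (fiberι f s) (2 * M) W) ∧
          IsOfHodgeType (2 * M) (fiberOver f s) (2 * M) M M (complexBetti.map (fiberι f s) (2 * M) W)) →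
        (∀ s : ComplexPoints S, ∃ (A' : AbelianVariety ℂ) (φ' : A' ⟶ A'), A'.dim = (2 * M) ∧
          CategoryStruct.comp φ' φ' = -((p : ℤ) • CategoryStruct.id A') ∧ Nonempty (A'.X ≅ fiberOver f s)) →
        ∀ (s t : ComplexPoints S) (hs : IsSmoothProjective (2 * M) (fiberOver f s))
          (ht : IsSmoothProjective (2 * M) (fiberOver f t)), HasAlgebraicTransport G f W s t hs ht

/-- `WeilPencilTransport` implies the route's transport crux `WeilVariationalHodge`
(given smoothness of the fibres, which abelian fibres have, and the cup-compatibility `hcup`).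
Stated; the proof is `algebraic_of_transport` fibre by fibre — left as the first stub of a line. -/
theorem weilVariationalHodge_of_pencilTransport
    (hcupAll : ∀ (X Y : SchemeOver ℂ) (N : ℕ) ⦃x : complexBetti (X ⊗ Y) (2 * N)⦄
      ⦃y : complexBetti (X ⊗ Y) (2 * (2 * N))⦄,
      x ∈ algebraicClasses (X ⊗ Y) N → y ∈ algebraicClasses (X ⊗ Y) (2 * N) →
        cupProduct (two_mul_add_two_mul N (2 * N)) x y ∈ algebraicClasses (X ⊗ Y) (N + 2 * N))
    (hfib : ∀ ⦃𝒳 S : SchemeOver ℂ⦄ (f : 𝒳 ⟶ S) (M : ℕ), IsSmoothProjectiveFamily f (2 * M) →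
      ∀ s : ComplexPoints S, IsSmoothProjective (2 * M) (fiberOver f s))
    (h : WeilPencilTransport G) : WeilVariationalHodge := by
  intro p hp hp4 hp7 M hM 𝒳 S f hf hirr hsm W hW hfibres ⟨s₀, hs₀⟩ s
  exact algebraic_of_transport G f W s₀ s (hfib f M hf s₀) (hfib f M hf s) (hcupAll _ _ M)
    (h p hp hp4 hp7 M hM f hf hirr hsm W hW hfibres s₀ s _ _) hs₀

end Pencil

end Summit.HodgeConjecture.HodgeConjecture.Cruxes.HodgeWeilLadder.IdeatorThree
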